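import Summits.HubbardSuperconductivity.HubbardSuperconductivity.Theorems.BalabanIRBirComplexStableXYRRotorWitnessCone
import HarnessLib

/-!
# RP-free long-range order of the `(2+1)`-dimensional XY rotor on `(ℤ/L)² × ℤ/M`:
# V. The crux's own conclusion on the real ferromagnetic cone

Fifth file of the BC5 witness for `BirComplexStableXYR` (stmt-HubbardSuperconductivity-14845,
route `BalabanIR`).  The crux `C` reads, for a complex finite Fourier table `c` on the window
`W_r = (Fin r)³` with symbol `F(φ) = ∑_n c_n e^{i n·φ}` and the shifts `sh_s`,

  `Z ≠ 0 ∧ 1/2 ≤ Re( ∫ O e^{−A} / Z )`,  `A(θ) = K ∑_s F(θ ∘ sh_s)`, `Z = ∫ e^{−A}`,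
  `O = |∑_x e^{iθ(x,0)}|² / L⁴`  (complex-valued integrals over the angle cube),

for `K ≥ K₀(r,B,c₀)`, `L₀ ≤ L ≤ M`, `L, M` even.  Here we prove THIS conclusion, verbatim (same
`sh, F, A, cube, Z, O`, complex integrals, `.re`), for every table `c` — in whatever `Finsupp`
presentation — whose symbol lies in the REAL FERROMAGNETIC CONE,
`F(φ) = ∑_{w,w'} J_{ww'}(1 − cos(φ_w − φ_{w'}))` with `J ≥ 0` and `J ≥ 1` on the three
nearest-neighbour window pairs, with constants `K₀, L₀` uniform in `r`, `J`, `c`, and WITHOUT the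
parity hypotheses (`birComplexStableXYR_realFerroCone`).  It is the special case of the crux on the
real ferromagnetic face of its table space (where (U1), (N), (C), (R), (P) hold automatically for
inversion-symmetric `J`), decided RP-free by files I–IV; the load of the crux — complex Berry
weights — is untouched.

## References
* C. Garban, T. Spencer, arXiv:2109.01617, Thm. 1.3 / Remark 1. [GarbanSpencer2022]
* J. Ginibre, Comm. Math. Phys. 16 (1970) 310–328. [Ginibre1970]
-/

noncomputable section

set_option linter.dupNamespace false -- summit = problem name (single-conjunct summit), D-0017

namespace Summit.HubbardSuperconductivity.HubbardSuperconductivity.Theorems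

open MeasureTheory Finset Set
open scoped BigOperators ComplexConjugate
open Literature.Probability.LatticeModels

/-- **BC5 WITNESS in the crux's own words: `BirComplexStableXYR` on the real ferromagnetic
cone, parity-free, RP-free.**  There are `K₀, L₀` such that for every `r ≥ 2`, every real table
`J ≥ 0` on `W_r × W_r` with `J ≥ 1` on the three nearest-neighbour window pairs, every `K ≥ K₀`,
every complex Fourier table `c : (W_r → ℤ) →₀ ℂ` whose symbol is
`∑_n c_n e^{i n·φ} = ∑_{w,w'} J_{ww'}(1 − cos(φ_w − φ_{w'}))`, and all `L₀ ≤ L ≤ M` (no evenness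
asked): with `sh, F, A, cube, Z, O` LITERALLY as in
`Summit.HubbardSuperconductivity.HubbardSuperconductivity.Theses.BalabanIR.BirComplexStableXYR`,
`Z ≠ 0 ∧ 1/2 ≤ Re(∫ O e^{−A} / Z)`.  Proof: the integrands are real (`Complex.ofReal`), and the
real statement is `birSliceFerroConeOrder_rpFree` (Garban–Spencer through imaginary time +
Ginibre). [cite: GarbanSpencer2022, Theorem 1.3 with Remark 1] -/
theorem birComplexStableXYR_realFerroCone :
    ∃ K₀ : ℝ, ∃ L₀ : ℕ, ∀ (r : ℕ) (hr : 1 < r) (J : (Fin r × Fin r × Fin r) → (Fin r × Fin r × Fin r) → ℝ), (∀ w w', 0 ≤ J w w') → 1 ≤ J (⟨0, Nat.zero_lt_of_lt hr⟩, ⟨0, Nat.zero_lt_of_lt hr⟩, ⟨0, Nat.zero_lt_of_lt hr⟩) (⟨1, hr⟩, ⟨0, Nat.zero_lt_of_lt hr⟩, ⟨0, Nat.zero_lt_of_lt hr⟩) → 1 ≤ J (⟨0, Nat.zero_lt_of_lt hr⟩, ⟨0, Nat.zero_lt_of_lt hr⟩, ⟨0, Nat.zero_lt_of_lt hr⟩)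 (⟨0, Nat.zero_lt_of_lt hr⟩, ⟨1, hr⟩, ⟨0, Nat.zero_lt_of_lt hr⟩) → 1 ≤ J (⟨0, Nat.zero_lt_of_lt hr⟩, ⟨0, Nat.zero_lt_of_lt hr⟩, ⟨0, Nat.zero_lt_of_lt hr⟩) (⟨0, Nat.zero_lt_of_lt hr⟩, ⟨0, Nat.zero_lt_of_lt hr⟩, ⟨1, hr⟩) → ∀ K : ℝ, K₀ ≤ K → ∀ c : ((Fin r × Fin r × Fin r) → ℤ) →₀ ℂ, (∀ φ : (Fin r × Fin r × Fin r) → ℝ, c.sum (fun n a => a * Complex.exp (Complex.I * ((∑ w, (n w : ℝ) * φ w : ℝ) : ℂ))) = ((∑ w, ∑ w', J w w' * (1 - Real.cos (φ w - φ w')) : ℝ) : ℂ)) → ∀ (L M : ℕ) [NeZero L] [NeZero M], L₀ ≤ L → L ≤ M → let sh : (Literature.Probability.LatticeModels.TorusSite 2 L × ZMod M) → (Fin r × Fin r × Fin r) → (Literature.Probability.LatticeModels.TorusSite 2 L × ZMod M) := fun s w => (s.1 + ![((w.1 : ℕ) : ZMod L), ((w.2.1 : ℕ) : ZMod L)], s.2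 + ((w.2.2 : ℕ) : ZMod M)); let F : ((Fin r × Fin r × Fin r) → ℝ) → ℂ := fun (φ : (Fin r × Fin r × Fin r) → ℝ) => c.sum (fun n a => a * Complex.exp (Complex.I * ((∑ w, (n w : ℝ) * φ w : ℝ) : ℂ))); let A : ((Literature.Probability.LatticeModels.TorusSite 2 L × ZMod M) → ℝ) → ℂ := fun θ => (K : ℂ) * ∑ s : (Literature.Probability.LatticeModels.TorusSite 2 L × ZMod M), F (fun w => θ (sh s w)); let cube : Set ((Literature.Probability.LatticeModels.TorusSite 2 L × ZMod M) → ℝ) := Set.pi Set.univ (fun _ => Set.Icc (0:ℝ) (2 * Real.pi)); let Z : ℂ := MeasureTheory.integral (MeasureTheory.volume.restrict cube) (fun θ => Complex.exp (-(A θ))); let O : ((Literature.Probability.LatticeModels.TorusSite 2 L × ZMod M) → ℝ) → ℝ := fun θ => ‖∑ x : Literature.Probability.LatticeModels.TorusSite 2 L, Complex.exp (Complex.I * (θ (x, 0) : ℂ))‖ ^ 2 / (L : ℝ) ^ 4; Z ≠ 0 ∧ (1/2 : ℝ) ≤ ((MeasureTheory.integral (MeasureTheory.volume.restrict cube) (fun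 θ => (O θ : ℂ) * Complex.exp (-(A θ)))) / Z).re := by
  obtain ⟨K₀, L₀, hcone⟩ := birSliceFerroConeOrder_rpFree
  refine ⟨K₀, L₀, ?_⟩
  intro r hr J hJnn hJ1 hJ2 hJ3 K hK c hc L M _ _ hL hLM
  have hreal := hcone r hr J hJnn hJ1 hJ2 hJ3 K hK L M hL hLM
  dsimp only at hreal ⊢
  obtain ⟨hZ, hO⟩ := hreal
  -- the complex action is the real one
  have hA : ∀ θ : (TorusSite 2 L × ZMod M) → ℝ,
      Complex.exp (-((K : ℂ) * ∑ s : (TorusSite 2 L × ZMod M),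
        c.sum (fun n a => a * Complex.exp (Complex.I *
          ((∑ w, (n w : ℝ) * θ (s.1 + ![((w.1 : ℕ) : ZMod L), ((w.2.1 : ℕ) : ZMod L)], s.2 + ((w.2.2 : ℕ) : ZMod M)) : ℝ) : ℂ))))) =
      ((Real.exp (-(K * ∑ s : (TorusSite 2 L × ZMod M), ∑ w, ∑ w', J w w' *
        (1 - Real.cos (θ (s.1 + ![((w.1 : ℕ) : ZMod L), ((w.2.1 : ℕ) : ZMod L)], s.2 + ((w.2.2 : ℕ) : ZMod M)) -
          θ (s.1 + ![((w'.1 : ℕ) : ZMod L), ((w'.2.1 : ℕ) : ZMod L)], s.2 + ((w'.2.2 : ℕ) : ZMod M)))))) : ℝ) : ℂ) := by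
    intro θ
    have h := fun s : (TorusSite 2 L × ZMod M) =>
      hc (fun w => θ (s.1 + ![((w.1 : ℕ) : ZMod L), ((w.2.1 : ℕ) : ZMod L)], s.2 + ((w.2.2 : ℕ) : ZMod M)))
    simp only [h, Complex.ofReal_exp]
    push_cast
    ring_nf
  simp only [hA]
  -- the complex integrals are real integrals
  have hnum : (fun θ : (TorusSite 2 L × ZMod M) → ℝ =>
      ((‖∑ x : TorusSite 2 L, Complex.exp (Complex.I * (θ (x, 0) : ℂ))‖ ^ 2 / (L : ℝ) ^ 4 : ℝ) : ℂ) *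
        ((Real.exp (-(K * ∑ s : (TorusSite 2 L × ZMod M), ∑ w, ∑ w', J w w' *
          (1 - Real.cos (θ (s.1 + ![((w.1 : ℕ) : ZMod L), ((w.2.1 : ℕ) : ZMod L)], s.2 + ((w.2.2 : ℕ) : ZMod M)) -
            θ (s.1 + ![((w'.1 : ℕ) : ZMod L), ((w'.2.1 : ℕ) : ZMod L)], s.2 + ((w'.2.2 : ℕ) : ZMod M)))))) : ℝ) : ℂ)) =
      fun θ => (((‖∑ x : TorusSite 2 L, Complex.exp (Complex.I * (θ (x, 0) : ℂ))‖ ^ 2 / (L : ℝ) ^ 4) *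
        Real.exp (-(K * ∑ s : (TorusSite 2 L × ZMod M), ∑ w, ∑ w', J w w' *
          (1 - Real.cos (θ (s.1 + ![((w.1 : ℕ) : ZMod L), ((w.2.1 : ℕ) : ZMod L)], s.2 + ((w.2.2 : ℕ) : ZMod M)) -
            θ (s.1 + ![((w'.1 : ℕ) : ZMod L), ((w'.2.1 : ℕ) : ZMod L)], s.2 + ((w'.2.2 : ℕ) : ZMod M)))))) : ℝ) : ℂ) := by
    funext θ; push_cast; ring
  rw [hnum, integral_complex_ofReal, integral_complex_ofReal]
  refine ⟨Complex.ofReal_ne_zero.2 (ne_of_gt hZ), ?_⟩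
  rw [← Complex.ofReal_div, Complex.ofReal_re]
  exact hO

end Summit.HubbardSuperconductivity.HubbardSuperconductivity.Theorems

end
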